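/-
Copyright (c) 2026 the pub-hodgecm-mathlib formalisation cell (harness21).  Prover seat hodgecm-mathlib-K2E3-p03 (g7), HCML Track B «K2-LIT» ∕ h413
(`stmt-HodgeConjecture-24833`), leaf (nsc-S-A′), the «(T)-programme for D94» (R0 13:43Z), file F1: TRANSPORT OF BOREL-INDUCED REPRESENTATIONS OF `GL₃(F)` AND OF
THE `P₁₂`-STANDARD MODULE ALONG `θ = gkAutomorphism` — the principal-series transport equivalence, STD-EMB′, IRR-T.  2026-09-04.
-/
import Summits.HodgeConjecture.HodgeConjecture.Theorems.K2E3GL3StandardModuleTransport      -- ★ (T-a): `exists_transportEquiv_D'`; brings ★ part 1, ★ T1, ★ E4b-T, SmoothIndTransport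
import Summits.HodgeConjecture.HodgeConjecture.Theorems.K2E3GL3StandardModuleEmbedding      -- ★ STD-EMB: `exists_injective_not_surjective_intertwiningMap`, `ker_inv_eq_ker`
import HarnessLib

/-!
# K2_E3 road (h413), leaf (nsc-S-A′) — transport of `Ind_B χ` and of `D′(x,y) = Ind_{P₁₂}((x ⊠ y∘det₂)δ^{1∕2})` along `θ(g) = w₀ ᵗg⁻¹ w₀`

Cell `pub/hodgecm-mathlib` (D-0151), Track B, seat K2E3-p03 (g7); `--supports stmt-HodgeConjecture-24833 --as helper`; THEOREMS ONLY (no `def`, no instance, no notation,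
no named fact, no `sorry`); never imports `Cruxes/…/Lines`.  COUNT-NEUTRAL generic helper of the «(T)-programme»: every `Q′ = P₁₂`-side brick of the C1′∕C1″
classification (IRR‴, IRR_low, NYA, STD-EMB′, …) is the TRANSPORT of a `Q = P₂₁`-side brick along the continuous involution `θ = gkAutomorphism` of `GL₃(F)`
(`θ(B) = B`, `θ(U) ⊆ U`, `θ(P₂₁) = P₁₂`; ★ T1 `K2E3GL3OuterAutomorphismInduction`, ★ E4b-T `K2E3GL3WeakCellLemmaTransport`).

THE MATHEMATICS ([BernsteinZelevinsky1977, §2.3]; [Zelevinsky1980, §1.1, Ex. 3.2]).  On the torus `θ_T(t₀,t₁,t₂) = (t₂⁻¹,t₁⁻¹,t₀⁻¹)` (★ part 1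
`tch_comp_leviAut_gkAutomorphism`) and `δ_B ∘ θ = δ_B` (★ `rootDeltaChar_transport`), so for characters `θv, θv′ : Fin 3 → (Fˣ →* ℂˣ)` with `θv′ = (θv₂⁻¹, θv₁⁻¹, θv₀⁻¹)`
the inducing data of `I(θv) = Ind_B(θv·δ_B^{1∕2})` and `I(θv′)` correspond under `θ`; ★ `SmoothInd.transportEquiv` (`f ↦ f ∘ θ⁻¹`) is then a linear isomorphism
**`Ξ : I(θv) ≃ I(θv′)` with `Ξ(I(θv)(g) f) = I(θv′)(θ g)(Ξ f)`** (§1).  Composing ★ (T-a) `Φ : D′(x,y) ≃_θ D(y⁻¹,x⁻¹)`, ★ STD-EMB `D(y⁻¹,x⁻¹) ↪ I(y⁻¹ν^{-½}, y⁻¹ν^{½}, x⁻¹)`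
and `Ξ` gives an honest (`θ∘θ = 1`) injective `GL₃(F)`-intertwining map **`D′(x,y) ↪ I(x, yν^{-½}, yν^{½})`** (§2, STD-EMB′), and ★ `isIrreducible_of_equivariant_equiv`
gives **`D′(x,y)` irreducible ⟺ `D(y⁻¹,x⁻¹)` irreducible** (§3, IRR-T) — so the irreducibility of the `P₁₂`-standard module of the «nested high» configuration is
EQUIVALENT to that of the `P₂₁`-standard module of the «nested low» configuration (one real proof for the pair IRR‴ ∕ IRR_low).

HONEST LABEL: HC_CM is proved only modulo the 7 printed citations (2 remaining named inputs: hLiu418 = stmt-HodgeConjecture-24832, h413 = stmt-HodgeConjecture-24833) until rung 0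
closes; count-neutral generic helper.

## Mathlib ∕ tree search
★ `SmoothInd.transportEquiv ∕ transportEquiv_smoothIndRep`, `rootDeltaChar_transport`, `isIrreducible_of_equivariant_equiv`, `symm_apply_of_equivariant` (Literature
`SmoothIndTransport`); ★ T1 `leviProjection_apply_eq_of_ker`, `gkAutomorphism_gkAutomorphism`; ★ E4b-T `gkAutomorphism_mem_borel_iff`; ★ part 1 `tch_comp_leviAut_gkAutomorphism`,
`gkAutomorphism_mem_unipotentRadicalP_borel`; ★ (T-a) `exists_transportEquiv_D'`; ★ STD-EMB `exists_injective_not_surjective_intertwiningMap`, `ker_inv_eq_ker`; Mathlib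
`Representation.IntertwiningMap` (structure), `IntertwiningMap.isIntertwining`.  Dedup: `rg "BorelInducedTransport|transportEquiv_principalSeries|isIrreducible_D'_iff"` — none.

## References
* [BernsteinZelevinsky1977] I. N. Bernstein, A. V. Zelevinsky, *Induced representations of reductive p-adic groups I*, Ann. Sci. ÉNS 10 (1977), §2.3.
* [Zelevinsky1980] A. V. Zelevinsky, *Induced representations of reductive p-adic groups II*, Ann. Sci. ÉNS 13 (1980), §1.1, Prop. 2.10, Ex. 3.2.
-/

set_option autoImplicit false
set_option linter.dupNamespace false

noncomputable section

open Function Representation Module Module.End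
open scoped MatrixGroups
open Literature.NumberTheory.Automorphic
open Summit.HodgeConjecture.HodgeConjecture.Cruxes.H413.K2E3GL3OuterAutomorphismInduction
open Summit.HodgeConjecture.HodgeConjecture.Cruxes.H413.K2E3JacquetWeightTransport
open Summit.HodgeConjecture.HodgeConjecture.Cruxes.H413.K2E3GL3StandardModuleTransport

namespace Summit.HodgeConjecture.HodgeConjecture.Cruxes.H413.K2E3GL3BorelInducedTransport

variable {F : Type} [Field F] [ValuativeRel F] [TopologicalSpace F] [IsNonarchimedeanLocalField F]

/-! ## §1 The principal-series transport equivalence `Ξ : I(θv) ≃_θ I(θv₂⁻¹, θv₁⁻¹, θv₀⁻¹)` -/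

/-- The torus character of `I(θv′)` at `θ_T(t)` is that of `I(θv)` at `t` when `θv′ = (θv₂⁻¹, θv₁⁻¹, θv₀⁻¹)` (★ part 1 `tch_comp_leviAut_gkAutomorphism`), for every `p ∈ B`
(`proj_B(θ p) = θ_T(proj_B p)`, ★ T1 `leviProjection_apply_eq_of_ker`). [cite: Zelevinsky1980, §1.1] -/
theorem borelChar_gkAutomorphism (θv θv' : Fin 3 → (Fˣ →* ℂˣ)) (h0 : θv' 0 = (θv 2)⁻¹) (h1 : θv' 1 = (θv 1)⁻¹) (h2 : θv' 2 = (θv 0)⁻¹)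
    (p : ↥(standardParabolicGL F (id : Fin 3 → Fin 3))) :
    (((∏ a : Fin 3, ((θv' a).comp (Matrix.GeneralLinearGroup.det.comp (Pi.evalMonoidHom (fun a : Fin 3 => GL {i : Fin 3 // (id : Fin 3 → Fin 3) i = a} F) a))))
        (leviProjection F (id : Fin 3 → Fin 3) ⟨gkAutomorphism (p : GL (Fin 3) F), (K2E3GL3WeakCellLemmaTransport.gkAutomorphism_mem_borel_iff F _).2 p.2⟩) : ℂˣ) : ℂ) =
      (((∏ a : Fin 3, ((θv a).comp (Matrix.GeneralLinearGroup.det.comp (Pi.evalMonoidHom (fun a : Fin 3 => GL {i : Fin 3 // (id : Fin 3 → Fin 3) i = a} F) a)))) (leviProjection F (id : Fin 3 → Fin 3) p) : ℂˣ) : ℂ) := by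
  have hproj := leviProjection_apply_eq_of_ker F (id : Fin 3 → Fin 3) (id : Fin 3 → Fin 3) (gkAutomorphism : GL (Fin 3) F ≃ₜ* GL (Fin 3) F).toMulEquiv
    (fun z => K2E3GL3WeakCellLemmaTransport.gkAutomorphism_mem_borel_iff F z) gkAutomorphism_mem_unipotentRadicalP_borel p
  have key := congrFun (tch_comp_leviAut_gkAutomorphism (F := F) θv') (leviProjection F (id : Fin 3 → Fin 3) p)
  have hvec : (![(θv' 2)⁻¹, (θv' 1)⁻¹, (θv' 0)⁻¹] : Fin 3 → (Fˣ →* ℂˣ)) = θv := by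
    funext a
    fin_cases a <;> refine MonoidHom.ext fun t => ?_ <;> simp [h0, h1, h2, MonoidHom.inv_apply]
  rw [hvec] at key
  have e : leviProjection F (id : Fin 3 → Fin 3) ⟨gkAutomorphism (p : GL (Fin 3) F), (K2E3GL3WeakCellLemmaTransport.gkAutomorphism_mem_borel_iff F _).2 p.2⟩ =
      leviProjection F (id : Fin 3 → Fin 3) ⟨gkAutomorphism (blockDiagonalGL F (id : Fin 3 → Fin 3) (leviProjection F (id : Fin 3 → Fin 3) p)),
        (K2E3GL3WeakCellLemmaTransport.gkAutomorphism_mem_borel_iff F _).2 (blockDiagonalGL_mem (id : Fin 3 → Fin 3) (leviProjection F (id : Fin 3 → Fin 3) p))⟩ := hproj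
  rw [e]
  exact key

/-- The inducing data of `I(θv)` at `p ∈ B` and of `I(θv′)` at `θ p` coincide (`δ_B ∘ θ = δ_B` ★ `rootDeltaChar_transport` and `borelChar_gkAutomorphism`).
[cite: BernsteinZelevinsky1977, §2.3] [cite: Zelevinsky1980, §1.1] -/
theorem inducingChar_borel_gkAutomorphism (θv θv' : Fin 3 → (Fˣ →* ℂˣ)) (h0 : θv' 0 = (θv 2)⁻¹) (h1 : θv' 1 = (θv 1)⁻¹) (h2 : θv' 2 = (θv 0)⁻¹)
    (p : ↥(standardParabolicGL F (id : Fin 3 → Fin 3))) :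
    (Representation.twist (((Representation.trivial ℂ (Π a : Fin 3, GL {i : Fin 3 // (id : Fin 3 → Fin 3) i = a} F) ℂ).twist
        (∏ a : Fin 3, ((θv a).comp (Matrix.GeneralLinearGroup.det.comp (Pi.evalMonoidHom (fun a : Fin 3 => GL {i : Fin 3 // (id : Fin 3 → Fin 3) i = a} F) a))))).comp
        (leviProjection F (id : Fin 3 → Fin 3))) (rootDeltaChar (standardParabolicGL F (id : Fin 3 → Fin 3)))) p =
      (Representation.twist (((Representation.trivial ℂ (Π a : Fin 3, GL {i : Fin 3 // (id : Fin 3 → Fin 3) i = a} F) ℂ).twist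
        (∏ a : Fin 3, ((θv' a).comp (Matrix.GeneralLinearGroup.det.comp (Pi.evalMonoidHom (fun a : Fin 3 => GL {i : Fin 3 // (id : Fin 3 → Fin 3) i = a} F) a))))).comp
        (leviProjection F (id : Fin 3 → Fin 3))) (rootDeltaChar (standardParabolicGL F (id : Fin 3 → Fin 3))))
        ⟨gkAutomorphism (p : GL (Fin 3) F), (K2E3GL3WeakCellLemmaTransport.gkAutomorphism_mem_borel_iff F _).2 p.2⟩ := by
  haveI : IsTopologicalRing F := inferInstance
  have hδ := rootDeltaChar_transport (gkAutomorphism : GL (Fin 3) F ≃ₜ* GL (Fin 3) F).toMulEquiv (gkAutomorphism : GL (Fin 3) F ≃ₜ* GL (Fin 3) F).continuous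
    (gkAutomorphism : GL (Fin 3) F ≃ₜ* GL (Fin 3) F).symm.continuous (H := standardParabolicGL F (id : Fin 3 → Fin 3))
    (H' := standardParabolicGL F (id : Fin 3 → Fin 3)) (fun z => K2E3GL3WeakCellLemmaTransport.gkAutomorphism_mem_borel_iff F z) p
  have hch := borelChar_gkAutomorphism θv θv' h0 h1 h2 p
  refine LinearMap.ext fun z => ?_
  simp only [Representation.twist_apply, MonoidHom.coe_comp, Function.comp_apply, Representation.trivial_apply]
  rw [hδ, hch]
  rfl

/-- **THE PRINCIPAL-SERIES TRANSPORT EQUIVALENCE**: for `θv′ = (θv₂⁻¹, θv₁⁻¹, θv₀⁻¹)` a linear isomorphism `Ξ : I(θv) ≃ I(θv′)` with `Ξ (I(θv)(g) f) = I(θv′)(θ g) (Ξ f)`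
(`θ = gkAutomorphism`; `I θ = parabolicIndGL F id (𝟙.twist (∏ₐ θₐ∘detₐ))`, the ★ E4a ∕ H0 spelling). [cite: BernsteinZelevinsky1977, §2.3] [cite: Zelevinsky1980, §1.1] -/
theorem exists_transportEquiv_principalSeries (θv θv' : Fin 3 → (Fˣ →* ℂˣ)) (h0 : θv' 0 = (θv 2)⁻¹) (h1 : θv' 1 = (θv 1)⁻¹) (h2 : θv' 2 = (θv 0)⁻¹) :
    ∃ Ξ : SmoothInd (standardParabolicGL F (id : Fin 3 → Fin 3))
        (Representation.twist (((Representation.trivial ℂ (Π a : Fin 3, GL {i : Fin 3 // (id : Fin 3 → Fin 3) i = a} F) ℂ).twist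
          (∏ a : Fin 3, ((θv a).comp (Matrix.GeneralLinearGroup.det.comp (Pi.evalMonoidHom (fun a : Fin 3 => GL {i : Fin 3 // (id : Fin 3 → Fin 3) i = a} F) a))))).comp
          (leviProjection F (id : Fin 3 → Fin 3))) (rootDeltaChar (standardParabolicGL F (id : Fin 3 → Fin 3)))) ≃ₗ[ℂ]
      SmoothInd (standardParabolicGL F (id : Fin 3 → Fin 3))
        (Representation.twist (((Representation.trivial ℂ (Π a : Fin 3, GL {i : Fin 3 // (id : Fin 3 → Fin 3) i = a} F) ℂ).twist
          (∏ a : Fin 3, ((θv' a).comp (Matrix.GeneralLinearGroup.det.comp (Pi.evalMonoidHom (fun a : Fin 3 => GL {i : Fin 3 // (id : Fin 3 → Fin 3) i = a} F) a))))).comp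
          (leviProjection F (id : Fin 3 → Fin 3))) (rootDeltaChar (standardParabolicGL F (id : Fin 3 → Fin 3)))),
      ∀ (g : GL (Fin 3) F) f, Ξ (Representation.parabolicIndGL F (id : Fin 3 → Fin 3) ((Representation.trivial ℂ (Π a : Fin 3, GL {i : Fin 3 // (id : Fin 3 → Fin 3) i = a} F) ℂ).twist
          (∏ a : Fin 3, ((θv a).comp (Matrix.GeneralLinearGroup.det.comp (Pi.evalMonoidHom (fun a : Fin 3 => GL {i : Fin 3 // (id : Fin 3 → Fin 3) i = a} F) a))))) g f) =
        Representation.parabolicIndGL F (id : Fin 3 → Fin 3) ((Representation.trivial ℂ (Π a : Fin 3, GL {i : Fin 3 // (id : Fin 3 → Fin 3) i = a} F) ℂ).twist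
          (∏ a : Fin 3, ((θv' a).comp (Matrix.GeneralLinearGroup.det.comp (Pi.evalMonoidHom (fun a : Fin 3 => GL {i : Fin 3 // (id : Fin 3 → Fin 3) i = a} F) a)))))
          (gkAutomorphism g) (Ξ f) := by
  haveI : IsTopologicalRing F := inferInstance
  refine ⟨SmoothInd.transportEquiv (gkAutomorphism : GL (Fin 3) F ≃ₜ* GL (Fin 3) F).toMulEquiv (gkAutomorphism : GL (Fin 3) F ≃ₜ* GL (Fin 3) F).continuous
    (gkAutomorphism : GL (Fin 3) F ≃ₜ* GL (Fin 3) F).symm.continuous (H := standardParabolicGL F (id : Fin 3 → Fin 3))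
    (H' := standardParabolicGL F (id : Fin 3 → Fin 3)) (fun z => K2E3GL3WeakCellLemmaTransport.gkAutomorphism_mem_borel_iff F z)
    (fun q => inducingChar_borel_gkAutomorphism θv θv' h0 h1 h2 q), fun g f => ?_⟩
  exact SmoothInd.transportEquiv_smoothIndRep _ _ _ _ _ g f

/-! ## §2 STD-EMB′: `D′(x,y) ↪ I(x, yν^{-½}, yν^{½})` injectively -/

/-- The three character identities `(x⁻¹)⁻¹ = x`, `(y⁻¹ν½)⁻¹ = yν½⁻¹`, `(y⁻¹ν½⁻¹)⁻¹ = yν½`. [folklore] -/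
theorem inv_letters (x y : Fˣ →* ℂˣ) :
    (![x, y * ((unramifiedTwist F (1 / 2) : QuasiChar F).toMonoidHom)⁻¹, y * ((unramifiedTwist F (1 / 2) : QuasiChar F).toMonoidHom)] : Fin 3 → (Fˣ →* ℂˣ)) 0 =
        ((![y⁻¹ * ((unramifiedTwist F (1 / 2) : QuasiChar F).toMonoidHom)⁻¹, y⁻¹ * ((unramifiedTwist F (1 / 2) : QuasiChar F).toMonoidHom), x⁻¹] : Fin 3 → (Fˣ →* ℂˣ)) 2)⁻¹ ∧
      (![x, y * ((unramifiedTwist F (1 / 2) : QuasiChar F).toMonoidHom)⁻¹, y * ((unramifiedTwist F (1 / 2) : QuasiChar F).toMonoidHom)] : Fin 3 → (Fˣ →* ℂˣ)) 1 =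
        ((![y⁻¹ * ((unramifiedTwist F (1 / 2) : QuasiChar F).toMonoidHom)⁻¹, y⁻¹ * ((unramifiedTwist F (1 / 2) : QuasiChar F).toMonoidHom), x⁻¹] : Fin 3 → (Fˣ →* ℂˣ)) 1)⁻¹ ∧
      (![x, y * ((unramifiedTwist F (1 / 2) : QuasiChar F).toMonoidHom)⁻¹, y * ((unramifiedTwist F (1 / 2) : QuasiChar F).toMonoidHom)] : Fin 3 → (Fˣ →* ℂˣ)) 2 =
        ((![y⁻¹ * ((unramifiedTwist F (1 / 2) : QuasiChar F).toMonoidHom)⁻¹, y⁻¹ * ((unramifiedTwist F (1 / 2) : QuasiChar F).toMonoidHom), x⁻¹] : Fin 3 → (Fˣ →* ℂˣ)) 0)⁻¹ := by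
  simp only [Matrix.cons_val_zero, Matrix.cons_val_one, Matrix.head_cons, Matrix.cons_val_two, Matrix.tail_cons]
  refine ⟨(inv_inv x).symm, MonoidHom.ext fun t => ?_, MonoidHom.ext fun t => ?_⟩ <;>
    simp only [MonoidHom.inv_apply, MonoidHom.mul_apply, mul_inv_rev, inv_inv] <;> exact mul_comm _ _

/-- **STD-EMB′ — THE `P₁₂`-STANDARD MODULE EMBEDS IN A PRINCIPAL SERIES**: an injective `GL₃(F)`-intertwining map `D′(x,y) ↪ I(x, yν^{-½}, yν^{½})`
(`= Ξ ∘ (★ STD-EMB at (y⁻¹, x⁻¹)) ∘ Φ`, honest because `θ ∘ θ = 1`; `D′` in the ★ WH0‴ ∕ GEO-QB‴ currency). [cite: Zelevinsky1980, Prop. 2.10, Ex. 3.2] [cite: BernsteinZelevinsky1977, §2.3] -/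
theorem exists_injective_intertwiningMap_D' (x y : Fˣ →* ℂˣ) (hx : IsOpen ((x.ker : Subgroup Fˣ) : Set Fˣ)) (hy : IsOpen ((y.ker : Subgroup Fˣ) : Set Fˣ)) :
    ∃ Ψ : (Representation.parabolicIndGL F (![false, true, true] : Fin 3 → Bool) ((Representation.trivial ℂ (Π a : Bool, GL {i : Fin 3 // (![false, true, true] : Fin 3 → Bool) i = a} F) ℂ).twist ((x.comp (Matrix.GeneralLinearGroup.det.comp (Pi.evalMonoidHom (fun a : Bool => GL {i : Fin 3 // (![false, true, true] : Fin 3 → Bool) i = a} F) false))) * (y.comp (Matrix.GeneralLinearGroup.det.comp (Pi.evalMonoidHom (fun a : Bool => GL {i : Fin 3 // (![false, true, true] : Fin 3 → Bool) i = a} F) true)))))).IntertwiningMap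
        (Representation.parabolicIndGL F (id : Fin 3 → Fin 3) ((Representation.trivial ℂ (Π a : Fin 3, GL {i : Fin 3 // (id : Fin 3 → Fin 3) i = a} F) ℂ).twist (∏ a : Fin 3, ((![x, y * ((unramifiedTwist F (1 / 2) : QuasiChar F).toMonoidHom)⁻¹, y * ((unramifiedTwist F (1 / 2) : QuasiChar F).toMonoidHom)] : Fin 3 → (Fˣ →* ℂˣ)) a).comp (Matrix.GeneralLinearGroup.det.comp (Pi.evalMonoidHom (fun a : Fin 3 => GL {i : Fin 3 // (id : Fin 3 → Fin 3) i = a} F) a))))),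
      Function.Injective Ψ := by
  have hx' : IsOpen ((x⁻¹.ker : Subgroup Fˣ) : Set Fˣ) := by rw [K2E3GL3StandardModuleEmbedding.ker_inv_eq_ker]; exact hx
  have hy' : IsOpen ((y⁻¹.ker : Subgroup Fˣ) : Set Fˣ) := by rw [K2E3GL3StandardModuleEmbedding.ker_inv_eq_ker]; exact hy
  have hΦ' := exists_transportEquiv_D' (F := F) x y
  obtain ⟨Φ, hΦ⟩ := hΦ'
  have hΨ₀' := K2E3GL3StandardModuleEmbedding.exists_injective_not_surjective_intertwiningMap y⁻¹ x⁻¹ hy' hx'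
  obtain ⟨Ψ₀, hΨ₀, -, -⟩ := hΨ₀'
  have hl := inv_letters (F := F) x y
  have hΞ' := exists_transportEquiv_principalSeries (F := F)
    (![y⁻¹ * ((unramifiedTwist F (1 / 2) : QuasiChar F).toMonoidHom)⁻¹, y⁻¹ * ((unramifiedTwist F (1 / 2) : QuasiChar F).toMonoidHom), x⁻¹] : Fin 3 → (Fˣ →* ℂˣ))
    (![x, y * ((unramifiedTwist F (1 / 2) : QuasiChar F).toMonoidHom)⁻¹, y * ((unramifiedTwist F (1 / 2) : QuasiChar F).toMonoidHom)] : Fin 3 → (Fˣ →* ℂˣ)) hl.1 hl.2.1 hl.2.2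
  obtain ⟨Ξ, hΞ⟩ := hΞ'
  refine ⟨{ toLinearMap := Ξ.toLinearMap ∘ₗ Ψ₀.toLinearMap ∘ₗ Φ.toLinearMap, isIntertwining' := fun g => LinearMap.ext fun v => ?_ }, ?_⟩
  · change Ξ (Ψ₀ (Φ (_))) = _
    rw [hΦ, Ψ₀.isIntertwining, hΞ, gkAutomorphism_gkAutomorphism]
    rfl
  · exact Ξ.injective.comp (hΨ₀.comp Φ.injective)

/-! ## §3 IRR-T: `D′(x,y)` irreducible ⟺ `D(y⁻¹,x⁻¹)` irreducible -/

/-- **IRR-T — TRANSPORT OF IRREDUCIBILITY BETWEEN THE TWO STANDARD MODULES**: `D′(x,y) = Ind_{P₁₂}((x ⊠ y∘det₂)δ^{1∕2})` is irreducible iff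
`D(y⁻¹,x⁻¹) = Ind_{P₂₁}((y⁻¹∘det₂ ⊠ x⁻¹)δ^{1∕2})` is (★ (T-a) `Φ` + ★ `isIrreducible_of_equivariant_equiv`). [cite: BernsteinZelevinsky1977, §2.3] [cite: Zelevinsky1980, §1.1] -/
theorem isIrreducible_D'_iff (x y : Fˣ →* ℂˣ) :
    (Representation.parabolicIndGL F (![false, true, true] : Fin 3 → Bool) ((Representation.trivial ℂ (Π a : Bool, GL {i : Fin 3 // (![false, true, true] : Fin 3 → Bool) i = a} F) ℂ).twist ((x.comp (Matrix.GeneralLinearGroup.det.comp (Pi.evalMonoidHom (fun a : Bool => GL {i : Fin 3 // (![false, true, true] : Fin 3 → Bool) i = a} F) false))) * (y.comp (Matrix.GeneralLinearGroup.det.comp (Pi.evalMonoidHom (fun a : Bool => GL {i : Fin 3 // (![false, true, true] : Fin 3 → Bool) i = a} F) true)))))).IsIrreducible ↔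
      (Representation.parabolicIndGL F (![false, false, true] : Fin 3 → Bool) ((Representation.trivial ℂ (Π a : Bool, GL {i : Fin 3 // (![false, false, true] : Fin 3 → Bool) i = a} F) ℂ).twist ((y⁻¹.comp (Matrix.GeneralLinearGroup.det.comp (Pi.evalMonoidHom (fun a : Bool => GL {i : Fin 3 // (![false, false, true] : Fin 3 → Bool) i = a} F) false))) * (x⁻¹.comp (Matrix.GeneralLinearGroup.det.comp (Pi.evalMonoidHom (fun a : Bool => GL {i : Fin 3 // (![false, false, true] : Fin 3 → Bool) i = a} F) true)))))).IsIrreducible := by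
  have hΦ' := exists_transportEquiv_D' (F := F) x y
  obtain ⟨Φ, hΦ⟩ := hΦ'
  constructor
  · intro h
    haveI := h
    exact isIrreducible_of_equivariant_equiv (gkAutomorphism : GL (Fin 3) F ≃ₜ* GL (Fin 3) F).toMulEquiv Φ hΦ
  · intro h
    haveI := h
    exact isIrreducible_of_equivariant_equiv (gkAutomorphism : GL (Fin 3) F ≃ₜ* GL (Fin 3) F).toMulEquiv.symm Φ.symm
      (symm_apply_of_equivariant (gkAutomorphism : GL (Fin 3) F ≃ₜ* GL (Fin 3) F).toMulEquiv Φ hΦ)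

end Summit.HodgeConjecture.HodgeConjecture.Cruxes.H413.K2E3GL3BorelInducedTransport

end
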